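import Literature.MathematicalPhysics.QuantumFieldTheory.Federbush1986.PlaquetteAverageV

/-!
# `Federbush1986.PlaquetteSumLimit` — the assembly lemma for [Federbush1987PhaseCellVI] Theorem 2 (abelian-analysis step):
# oriented plaquette sums of magnitudes admitting the expansion `|g_∂p| ≈ ‖P_r(p) + ℓ_r²C(x_p)‖` converge to
# `∫ Σ_{μ≠ν} ‖F_μν + C_μν‖²`, and every level's sum is a convergent series — carrier-free, for r19's `Theorem2Oriented`

statement-level skeleton of published theorems with citation tags; proofs where landed; nothing here is a claim about the Yang–Mills mass gap

CITATION HEADER.  P. Federbush, *A phase cell approach to Yang–Mills theory. VI. Non-abelian lattice-continuum duality*,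
Ann. Inst. H. Poincaré **47** (1987) 17–23 [Federbush1987PhaseCellVI]: (10) p. 20 «S^r_0 = ¼Σ_p|g_∂p|²», Theorem 2 p. 20
«Let A_μ(x) be continuously differentiable, and let A_μ(x) and its first partial derivatives fall off at infinity faster
than 1/x^{2+ε} … Then, for the compatible set of lattice assignments associated to A_μ(x), the corresponding lattice
actions, S^r_0, converge to the continuum action [½∫(dA + A∧A)², p. 18] as r → ∞», (32) p. 23; P. Federbush, *… I*,
Commun. Math. Phys. **107** (1986) 319–329 [Federbush1986PhaseCellI], (1.13)–(1.14) p. 324, §4 p. 329.  Unit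
`lit-balaban-r17` gen 4 (fold owner of the Federbush block); SKELETON row **F6.Thm2** of
`run/shared/lean/pub/lit-balaban/lit-balaban-r17/SKELETON-r17.md` — Phase-2 split of record (HOME/STATUS 2026-08-21T05:13Z–
06:06Z): seat r19 proves the non-abelian per-plaquette expansion of `|g_∂p|` for the associated family (BCH p250080,
translation p250673, cascade in progress); this module is the analysis that turns such an expansion into the three
conjuncts of `Theorem2Oriented` (summability per level, integrability of the density, the limit), up to the factor
`¼·2 = ½` (`pairDensity_eq_two_mul`).

THE MATHEMATICS.  Let `m_r(p) ≥ 0` (the plaquette magnitudes `|g_∂p(g(r))|`), `P_r` the 𝔤-valued continuum plaquette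
functional (1.13) of the `C¹` potential `A`, `C_μν` continuous (the commutator `[A_μ, A_ν]`), and suppose the expansion in
BOX-STEP form: for every point `x` with lattice box index `b = ⌊x/ℓ_r⌋`,
`| m_r(b;μ,ν)/ℓ_r² − ‖P_r(b;μ,ν)/ℓ_r² + C_μν(ℓ_r b)‖ | ≤ e_r(x)`, `e_r(x) → 0`, `|e_r| ≤ G`, and `‖F_μν‖, ‖C_μν‖ ≤ g(‖·‖)`
with `g` antitone and `(2g(‖x‖−6) + G(x))²` integrable.  Then with `c_r(b) = ℓ_r^{−4}Σ_{μ≠ν}m_r(b;μ,ν)²` the box-step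
functions `c_r(⌊x/ℓ_r⌋)` are dominated by `16(2g(‖x‖−6)+G)²` (`P_r/ℓ² ≤ g(‖x‖−6)` by `norm_plaqFunctionalV_le_of_envelope`,
`‖C(ℓb)‖ ≤ g(‖x‖−2)`) and converge pointwise to `Σ_{μ≠ν}‖F_μν(x) + C_μν(x)‖²` (`tendsto_plaqFunctionalV_div_sq`,
continuity of `C`, `tendsto_cornerPt`), so `Σ_p[μ≠ν]m_r² = Σ_bℓ⁴c_r(b) → ∫Σ_{μ≠ν}‖F+C‖²`
(`LatticeRiemann.tendsto_latticeSum_of_dominated`), every level's sum converges (`summable_of_dominated`,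
`tsum_plaq_eq_tsum_base`), and the density is integrable.

WHAT THIS MODULE PROVIDES (plumbing defs `pairDensity`, `plaqTermM`, `cellDensityM`; no `Prop` definition, no named fact;
axioms standard): `plaqTermM_nonneg`, `latLen_pow_mul_cellDensityM`, `continuous_pairDensity`,
**`tendsto_plaqSum_of_expansion`** (the assembly lemma), `curlV_swap`, **`pairDensity_eq_two_mul`**.
-/

namespace Literature.MathematicalPhysics.QuantumFieldTheory.Federbush1986

noncomputable section

open MeasureTheory Filter Set intervalIntegral
open scoped Topology BigOperators

/-! ## Assembly: oriented plaquette sums of magnitudes admitting the expansion `m ≈ ‖P + ℓ²C‖` converge to `∫Σ‖F + C‖²` -/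

section Assembly

open LatticeRiemann

variable {V : Type*} [NormedAddCommGroup V] [NormedSpace ℝ V] [CompleteSpace V]

/-- The target density `Σ_{μ≠ν} ‖F_μν(x) + C_μν(x)‖²` (for `C_μν = [A_μ, A_ν]`: twice the integrand `Σ_{μ<ν}` of the continuum
action «½∫(dA + A∧A)²»). [cite: Federbush1987PhaseCellVI, p. 18, Theorem 2 p. 20] -/
def pairDensity (A : E4 → Fin 4 → V) (C : Fin 4 → Fin 4 → E4 → V) (x : E4) : ℝ :=
  ∑ μ : Fin 4, ∑ ν : Fin 4, if μ ≠ ν then ‖curlV A μ ν x + C μ ν x‖ ^ 2 else 0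

/-- The oriented plaquette term `[dir₁ ≠ dir₂]·m_r(p)²` of a family of plaquette magnitudes (for `m = |g_∂p|`: four times
the summand of (10) in the reading of record). [cite: Federbush1987PhaseCellVI, (10) p. 20] -/
def plaqTermM (m : (r : ℕ) → Plaq r → ℝ) (r : ℕ) (p : Plaq r) : ℝ := if p.dir₁ ≠ p.dir₂ then m r p ^ 2 else 0

/-- The box density `ℓ_r^{−4} Σ_{μ≠ν} m_r(b;μ,ν)²`. [cite: Federbush1987PhaseCellVI, (10) p. 20] -/
def cellDensityM (m : (r : ℕ) → Plaq r → ℝ) (r : ℕ) (b : Fin 4 → ℤ) : ℝ :=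
  (latLen r ^ 4)⁻¹ * ∑ μ : Fin 4, ∑ ν : Fin 4, plaqTermM m r ⟨b, μ, ν⟩

omit [NormedSpace ℝ V] [CompleteSpace V] in
/-- `plaqTermM ≥ 0`. [cite: Federbush1987PhaseCellVI, (10) p. 20] -/
theorem plaqTermM_nonneg (m : (r : ℕ) → Plaq r → ℝ) (r : ℕ) (p : Plaq r) : 0 ≤ plaqTermM m r p := by
  unfold plaqTermM; split_ifs; exacts [sq_nonneg _, le_rfl]

/-- `ℓ_r⁴ · cellDensityM = Σ_{μ,ν} plaqTermM`. [cite: Federbush1987PhaseCellVI, (10) p. 20] -/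
theorem latLen_pow_mul_cellDensityM (m : (r : ℕ) → Plaq r → ℝ) (r : ℕ) (b : Fin 4 → ℤ) :
    latLen r ^ 4 * cellDensityM m r b = ∑ μ : Fin 4, ∑ ν : Fin 4, plaqTermM m r ⟨b, μ, ν⟩ := by
  unfold cellDensityM
  rw [← mul_assoc, mul_inv_cancel₀ (pow_ne_zero _ (latLen_pos r).ne'), one_mul]

omit [CompleteSpace V] in
/-- A radial envelope of a norm is non-negative. [folklore] -/
private theorem envelopeV_nonneg {A : E4 → Fin 4 → V} {g : ℝ → ℝ} (hg : Antitone g)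
    (hdom : ∀ y μ ν, ‖curlV A μ ν y‖ ≤ g ‖y‖) (t : ℝ) : 0 ≤ g t := by
  have h0 : 0 ≤ g 0 := (norm_nonneg _).trans (by simpa using hdom 0 0 0)
  by_cases ht' : t ≤ 0
  · exact h0.trans (hg ht')
  · have ht : 0 < t := lt_of_not_ge ht'
    have hn : ‖(t • unitVec 0 : E4)‖ = t := by
      rw [norm_smul, Real.norm_eq_abs, abs_of_pos ht]
      unfold unitVec; simp
    have h := hdom (t • unitVec 0) 0 0
    rw [hn] at h
    exact (norm_nonneg _).trans h

omit [CompleteSpace V] in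
/-- The pair density is continuous for a `C¹` potential and continuous `C`. [cite: Federbush1987PhaseCellVI, Theorem 2 p. 20] -/
theorem continuous_pairDensity {A : E4 → Fin 4 → V} (hA : ContDiff ℝ 1 A) {C : Fin 4 → Fin 4 → E4 → V}
    (hC : ∀ μ ν, Continuous (C μ ν)) : Continuous (pairDensity A C) := by
  unfold pairDensity
  refine continuous_finsetSum _ fun μ _ => continuous_finsetSum _ fun ν _ => ?_
  by_cases h : μ ≠ ν
  · simp only [if_pos h]
    exact ((continuous_curlV hA μ ν).add (hC μ ν)).norm.pow 2
  · simp only [if_neg h]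
    exact continuous_const

/-- **The assembly lemma for Theorem 2 (abelian-analysis step).**  Let `m_r(p) ≥ 0` be plaquette magnitudes (e.g.
`|g_∂p(g(r))|`) admitting, in box-step form, the expansion `m_r/ℓ_r² = ‖P_r/ℓ_r² + C(x_p)‖ + (error → 0, dominated)`, where
`P_r` is the continuum plaquette functional (1.13) of a `C¹` potential `A`, `C_μν` is continuous (e.g. `[A_μ, A_ν]`), and
`‖F_μν‖, ‖C_μν‖` have a common antitone radial envelope `g` with `(2g(‖x‖−6) + G)²` integrable.  Then every level's
oriented plaquette sum `Σ_p [μ≠ν] m_r(p)²` is a convergent series, the density `Σ_{μ≠ν}‖F_μν + C_μν‖²` is integrable, and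
`Σ_p [μ≠ν] m_r(p)² → ∫ Σ_{μ≠ν}‖F_μν + C_μν‖²` — dominated convergence of the lattice sums (`LatticeRiemann`).
[cite: Federbush1987PhaseCellVI, (10) and Theorem 2 p. 20, (32) p. 23; Federbush1986PhaseCellI, §4 p. 329] -/
theorem tendsto_plaqSum_of_expansion {A : E4 → Fin 4 → V} (hA : ContDiff ℝ 1 A) {C : Fin 4 → Fin 4 → E4 → V}
    (hC : ∀ μ ν, Continuous (C μ ν)) (m : (r : ℕ) → Plaq r → ℝ) (hm : ∀ r p, 0 ≤ m r p) {g : ℝ → ℝ}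
    (hg : Antitone g) (hgF : ∀ y μ ν, ‖curlV A μ ν y‖ ≤ g ‖y‖) (hgC : ∀ y μ ν, ‖C μ ν y‖ ≤ g ‖y‖)
    (e : ℕ → E4 → ℝ) (he : ∀ x, Tendsto (fun r => e r x) atTop (𝓝 0)) {G : E4 → ℝ} (heG : ∀ r x, |e r x| ≤ G x)
    (hint : Integrable fun x : E4 => (2 * g (‖x‖ - 6) + G x) ^ 2)
    (herr : ∀ r x μ ν, μ ≠ ν →
      |m r ⟨floorIdx (latLen r) x, μ, ν⟩ / latLen r ^ 2
        - ‖(latLen r ^ 2)⁻¹ • plaqFunctionalV r A ⟨floorIdx (latLen r) x, μ, ν⟩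
            + C μ ν (cornerPt (latLen r) (floorIdx (latLen r) x))‖| ≤ e r x) :
    (∀ r, Summable (plaqTermM m r)) ∧ Integrable (pairDensity A C) ∧
      Tendsto (fun r => ∑' p : Plaq r, plaqTermM m r p) atTop (𝓝 (∫ x, pairDensity A C x)) := by
  have hg0 : ∀ t, 0 ≤ g t := envelopeV_nonneg hg hgF
  have hG0 : ∀ x, 0 ≤ G x := fun x => (abs_nonneg _).trans (heG 0 x)
  -- the main term and its limit / domination
  set Q : ℕ → E4 → Fin 4 → Fin 4 → ℝ := fun r x μ ν =>
    ‖(latLen r ^ 2)⁻¹ • plaqFunctionalV r A ⟨floorIdx (latLen r) x, μ, ν⟩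
      + C μ ν (cornerPt (latLen r) (floorIdx (latLen r) x))‖ with hQ
  have hQlim : ∀ x μ ν, Tendsto (fun r => Q r x μ ν) atTop (𝓝 ‖curlV A μ ν x + C μ ν x‖) := by
    intro x μ ν
    exact ((tendsto_plaqFunctionalV_div_sq hA x μ ν).add
      (((hC μ ν).tendsto x).comp (tendsto_cornerPt x))).norm
  have hQdom : ∀ r x μ ν, Q r x μ ν ≤ 2 * g (‖x‖ - 6) := by
    intro r x μ ν
    have hℓ := latLen_pos r
    have h1 : ‖(latLen r ^ 2)⁻¹ • plaqFunctionalV r A ⟨floorIdx (latLen r) x, μ, ν⟩‖ ≤ g (‖x‖ - 6) := by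
      rw [norm_smul, norm_inv, Real.norm_eq_abs, abs_of_pos (by positivity : (0:ℝ) < latLen r ^ 2)]
      have := norm_plaqFunctionalV_le_of_envelope hA hg hgF r x μ ν
      calc (latLen r ^ 2)⁻¹ * ‖plaqFunctionalV r A ⟨floorIdx (latLen r) x, μ, ν⟩‖
          ≤ (latLen r ^ 2)⁻¹ * (g (‖x‖ - 6) * latLen r ^ 2) := by gcongr
        _ = g (‖x‖ - 6) := by field_simp
    have h2 : ‖C μ ν (cornerPt (latLen r) (floorIdx (latLen r) x))‖ ≤ g (‖x‖ - 6) := by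
      refine (hgC _ μ ν).trans (hg ?_)
      have h3 := norm_sub_cornerPt_le hℓ x
      have h4 : latLen r ≤ 1 := by unfold latLen; exact inv_le_one_of_one_le₀ (one_le_pow₀ (by norm_num))
      have h5 := norm_sub_norm_le x (cornerPt (latLen r) (floorIdx (latLen r) x))
      linarith
    calc Q r x μ ν ≤ ‖(latLen r ^ 2)⁻¹ • plaqFunctionalV r A ⟨floorIdx (latLen r) x, μ, ν⟩‖
          + ‖C μ ν (cornerPt (latLen r) (floorIdx (latLen r) x))‖ := norm_add_le _ _
      _ ≤ g (‖x‖ - 6) + g (‖x‖ - 6) := add_le_add h1 h2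
      _ = 2 * g (‖x‖ - 6) := by ring
  -- the normalised magnitudes: limit and domination
  have hMlim : ∀ x μ ν, μ ≠ ν →
      Tendsto (fun r => m r ⟨floorIdx (latLen r) x, μ, ν⟩ / latLen r ^ 2) atTop (𝓝 ‖curlV A μ ν x + C μ ν x‖) := by
    intro x μ ν hμν
    have h1 : Tendsto (fun r => m r ⟨floorIdx (latLen r) x, μ, ν⟩ / latLen r ^ 2 - Q r x μ ν) atTop (𝓝 0) :=
      squeeze_zero_norm (fun r => by rw [Real.norm_eq_abs]; exact herr r x μ ν hμν) (he x)
    have h2 := h1.add (hQlim x μ ν)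
    simp only [zero_add, sub_add_cancel] at h2
    exact h2
  have hMdom : ∀ r x μ ν, μ ≠ ν → m r ⟨floorIdx (latLen r) x, μ, ν⟩ / latLen r ^ 2 ≤ 2 * g (‖x‖ - 6) + G x := by
    intro r x μ ν hμν
    have h1 := herr r x μ ν hμν
    have h2 := (abs_sub_le_iff.1 h1).1
    linarith [hQdom r x μ ν, heG r x, le_abs_self (e r x)]
  have hMnn : ∀ r x μ ν, 0 ≤ m r ⟨floorIdx (latLen r) x, μ, ν⟩ / latLen r ^ 2 :=
    fun r x μ ν => div_nonneg (hm _ _) (pow_nonneg (latLen_pos r).le _)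
  -- box densities: domination and limit
  set H : E4 → ℝ := fun x => 2 * g (‖x‖ - 6) + G x with hH
  have hH0 : ∀ x, 0 ≤ H x := fun x => by rw [hH]; linarith [hg0 (‖x‖ - 6), hG0 x]
  have hterm_eq : ∀ r x μ ν, (latLen r ^ 4)⁻¹ * plaqTermM m r ⟨floorIdx (latLen r) x, μ, ν⟩
      = if μ ≠ ν then (m r ⟨floorIdx (latLen r) x, μ, ν⟩ / latLen r ^ 2) ^ 2 else 0 := by
    intro r x μ ν
    unfold plaqTermM
    split_ifs
    · have hℓ := (latLen_pos r).ne'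
      field_simp
    · rw [mul_zero]
  have hdom : ∀ r x, |cellDensityM m r (floorIdx (latLen r) x)| ≤ 16 * H x ^ 2 := by
    intro r x
    have hnn : 0 ≤ cellDensityM m r (floorIdx (latLen r) x) :=
      mul_nonneg (inv_nonneg.2 (pow_nonneg (latLen_pos r).le _))
        (Finset.sum_nonneg fun _ _ => Finset.sum_nonneg fun _ _ => plaqTermM_nonneg _ _ _)
    rw [abs_of_nonneg hnn]
    unfold cellDensityM
    rw [Finset.mul_sum]
    simp_rw [Finset.mul_sum, hterm_eq]
    have hT : ∀ μ ν : Fin 4, (if μ ≠ ν then (m r ⟨floorIdx (latLen r) x, μ, ν⟩ / latLen r ^ 2) ^ 2 else 0) ≤ H x ^ 2 := by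
      intro μ ν
      split_ifs with hμν
      · exact pow_le_pow_left₀ (hMnn r x μ ν) (hMdom r x μ ν hμν) 2
      · positivity
    calc ∑ μ : Fin 4, ∑ ν : Fin 4, (if μ ≠ ν then (m r ⟨floorIdx (latLen r) x, μ, ν⟩ / latLen r ^ 2) ^ 2 else 0)
        ≤ ∑ _μ : Fin 4, ∑ _ν : Fin 4, H x ^ 2 := by gcongr with μ _ ν _; exact hT μ ν
      _ = 16 * H x ^ 2 := by simp only [Finset.sum_const, Finset.card_univ, Fintype.card_fin]; ring
  have hlim : ∀ x, Tendsto (fun r => cellDensityM m r (floorIdx (latLen r) x)) atTop (𝓝 (pairDensity A C x)) := by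
    intro x
    have hterm : ∀ μ ν : Fin 4, Tendsto (fun r => (latLen r ^ 4)⁻¹ * plaqTermM m r ⟨floorIdx (latLen r) x, μ, ν⟩)
        atTop (𝓝 (if μ ≠ ν then ‖curlV A μ ν x + C μ ν x‖ ^ 2 else 0)) := by
      intro μ ν
      simp_rw [hterm_eq]
      by_cases hμν : μ ≠ ν
      · simp only [if_pos hμν]
        exact (hMlim x μ ν hμν).pow 2
      · simp only [if_neg hμν]
        exact tendsto_const_nhds
    unfold cellDensityM pairDensity
    simp_rw [Finset.mul_sum]
    exact tendsto_finsetSum _ fun μ _ => tendsto_finsetSum _ fun ν _ => hterm μ ν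
  have hint16 : Integrable fun x : E4 => 16 * H x ^ 2 := hint.const_mul 16
  -- (i) summability at each level
  have hsumB : ∀ r, Summable (cellDensityM m r) := fun r =>
    summable_of_dominated (latLen_pos r) _ _ hint16 (hdom r)
  have hplaq : ∀ r, Summable (plaqTermM m r) ∧
      ∑' p, plaqTermM m r p = ∑' b : Fin 4 → ℤ, ∑ μ : Fin 4, ∑ ν : Fin 4, plaqTermM m r ⟨b, μ, ν⟩ := by
    intro r
    refine tsum_plaq_eq_tsum_base (plaqTermM m r) (plaqTermM_nonneg m r) ?_
    have := (hsumB r).mul_left (latLen r ^ 4)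
    simpa only [latLen_pow_mul_cellDensityM] using this
  refine ⟨fun r => (hplaq r).1, ?_, ?_⟩
  · -- (ii) integrability of the density
    refine hint16.mono' (continuous_pairDensity hA hC).aestronglyMeasurable (Eventually.of_forall fun x => ?_)
    have hnn : 0 ≤ pairDensity A C x :=
      Finset.sum_nonneg fun _ _ => Finset.sum_nonneg fun _ _ => by split_ifs; exacts [sq_nonneg _, le_rfl]
    rw [Real.norm_eq_abs, abs_of_nonneg hnn]
    unfold pairDensity
    have hT : ∀ μ ν : Fin 4, (if μ ≠ ν then ‖curlV A μ ν x + C μ ν x‖ ^ 2 else 0) ≤ H x ^ 2 := by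
      intro μ ν
      split_ifs
      · refine pow_le_pow_left₀ (norm_nonneg _) ?_ 2
        have hgx : g ‖x‖ ≤ g (‖x‖ - 6) := hg (by linarith)
        calc ‖curlV A μ ν x + C μ ν x‖ ≤ ‖curlV A μ ν x‖ + ‖C μ ν x‖ := norm_add_le _ _
          _ ≤ g ‖x‖ + g ‖x‖ := add_le_add (hgF x μ ν) (hgC x μ ν)
          _ ≤ H x := by rw [hH]; linarith [hG0 x]
      · positivity
    calc ∑ μ : Fin 4, ∑ ν : Fin 4, (if μ ≠ ν then ‖curlV A μ ν x + C μ ν x‖ ^ 2 else 0)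
        ≤ ∑ _μ : Fin 4, ∑ _ν : Fin 4, H x ^ 2 := by gcongr with μ _ ν _; exact hT μ ν
      _ = 16 * H x ^ 2 := by simp only [Finset.sum_const, Finset.card_univ, Fintype.card_fin]; ring
  · -- (iii) the limit
    have h := tendsto_latticeSum_of_dominated latLen latLen_pos (fun r b => cellDensityM m r b) (pairDensity A C)
      (fun x => 16 * H x ^ 2) hint16 hdom hlim
    refine h.congr fun r => ?_
    rw [(hplaq r).2]
    simp_rw [latLen_pow_mul_cellDensityM]

end Assembly

/-! ### From ordered pairs `μ ≠ ν` to `μ < ν` (the factor 2 between `¼Σ_{oriented}` and `½∫Σ_{μ<ν}`) -/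

section Symm

variable {V : Type*} [NormedAddCommGroup V] [NormedSpace ℝ V]

/-- `F_νμ = −F_μν`. [cite: Federbush1987PhaseCellVI, p. 18] -/
theorem curlV_swap (A : E4 → Fin 4 → V) (μ ν : Fin 4) (x : E4) : curlV A ν μ x = -curlV A μ ν x := by
  unfold curlV; abel

/-- For an antisymmetric `C` (e.g. the commutator `[A_μ, A_ν]`), `Σ_{μ≠ν}‖F_μν + C_μν‖² = 2·Σ_{μ<ν}‖F_μν + C_μν‖²` — the
integrand of `pairDensity` is twice that of `contActionDensity`. [cite: Federbush1987PhaseCellVI, p. 18, (10) and Theorem 2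
p. 20] -/
theorem pairDensity_eq_two_mul (A : E4 → Fin 4 → V) {C : Fin 4 → Fin 4 → E4 → V}
    (hC : ∀ μ ν x, C ν μ x = -C μ ν x) (x : E4) :
    pairDensity A C x = 2 * ∑ μ : Fin 4, ∑ ν : Fin 4, if μ < ν then ‖curlV A μ ν x + C μ ν x‖ ^ 2 else 0 := by
  unfold pairDensity
  set f : Fin 4 → Fin 4 → ℝ := fun μ ν => ‖curlV A μ ν x + C μ ν x‖ ^ 2 with hf
  have hsym : ∀ μ ν, f ν μ = f μ ν := by
    intro μ ν
    simp only [hf, curlV_swap A μ ν, hC μ ν, ← neg_add, norm_neg]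
  have hsplit : ∀ μ ν : Fin 4, (if μ ≠ ν then f μ ν else 0) = (if μ < ν then f μ ν else 0) + (if ν < μ then f μ ν else 0) := by
    intro μ ν
    rcases lt_trichotomy μ ν with h | h | h
    · rw [if_pos h.ne, if_pos h, if_neg (not_lt.2 h.le), add_zero]
    · subst h; simp
    · rw [if_pos h.ne', if_neg (not_lt.2 h.le), if_pos h, zero_add]
  have h1 : ∑ μ : Fin 4, ∑ ν : Fin 4, (if μ ≠ ν then f μ ν else 0)
      = (∑ μ : Fin 4, ∑ ν : Fin 4, if μ < ν then f μ ν else 0)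
        + ∑ μ : Fin 4, ∑ ν : Fin 4, (if ν < μ then f μ ν else 0) := by
    simp_rw [hsplit, Finset.sum_add_distrib]
  have h2 : ∑ μ : Fin 4, ∑ ν : Fin 4, (if ν < μ then f μ ν else 0)
      = ∑ μ : Fin 4, ∑ ν : Fin 4, (if μ < ν then f μ ν else 0) := by
    rw [Finset.sum_comm]
    refine Finset.sum_congr rfl fun μ _ => Finset.sum_congr rfl fun ν _ => ?_
    split_ifs with h
    · exact hsym μ ν
    · rfl
  change ∑ μ : Fin 4, ∑ ν : Fin 4, (if μ ≠ ν then f μ ν else 0) = 2 * ∑ μ : Fin 4, ∑ ν : Fin 4, (if μ < ν then f μ ν else 0)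
  rw [h1, h2]
  ring

end Symm

end

end Literature.MathematicalPhysics.QuantumFieldTheory.Federbush1986
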